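import Mathlib
import HarnessLib
import HarnessLib.Audit
import Summits.AtomisticToContinuum.Statement
import Summits.AtomisticToContinuum.BoseEinsteinCondensation.Theorems.BECInfraredBoundAssembly
import HarnessLib.Audit.Status.Attr

/-!
Route: BECDeletionChiSquare

DORMANT since 2026-08-23T03:24:44Z (reconciler: no traction for 5.9 d (last activity item-evidence-added at 2026-08-17T06:02:59Z); parked, not closed — `ledger route dormant route-AtomisticToContinuum-BECDeletionChiSquare --off` to reac) — unstaffed, not closed; items shared with open routes are served there. `ledger route dormant <id> --off` reactivates.

# Route BECDeletionChiSquare — BEC from chi-square deletion tolerance of the positive ground state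
(n₀ ≥ N/E[L³p(x₁|rest)], one Hölder line), benchmarked on the bosonized 3-D Fermi sea

It suffices to show X = ChiSquareTolerance ∧ DeletionReachesGroundState (card
chi2-deletion-tolerance-fermi-benchmark, gen-2 conforming
re-opening of the retired route BECDeletionTolerance with the same decls and a certified deciding
theorem). ChiSquareTolerance (the card's C1
in its liminf form, Dirichlet box of side L = (N/ρ)^(1/3)): for every repulsive finite-range v, all
small ρ, some C = C(v,ρ), all large
N = n+1 and EVERY slack δ > 0, SOME δ-near-minimiser Ψ of the N-body Dirichlet energy has mean
self-conditional density
m₂(Ψ) := L³ ∫_Y ∫_x |Ψ(x,Y)|⁴ / (∫_x' |Ψ(x',Y)|²) ≤ C, i.e. E_μ[L³ p(x₁ | x₂…x_N)] ≤ C for the Born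
law μ = |Ψ|² — m₂ = 1 + χ²(μ ‖ unif ⊗ marginal)
is the chi-square insertion/deletion tolerance of the ground-state point process.
DeletionReachesGroundState (frame crux): at fixed large N the
liminf bound passes through the unique positive ground state Ψ₀ (m₂ lower semicontinuous, n₀
L²-continuous) and the exact one-line inequality
n₀(Ψ) ≥ N/m₂(Ψ) for Ψ ≥ 0 (support DeletionBound: Hölder in x, Cauchy–Schwarz in Y) to give ⟨φ₀, γ_Ψ
φ₀⟩ ≥ N/(2C) for EVERY δ-near-minimiser,
φ₀ = L^(-3/2)·1_box; this is the zero-mode criterion X_B1 whose implication to the conjunct is the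
PROVED theorem
AtomisticToContinuum.BECInfraredBound.bec_of_zeroMode. Off the deciding path the route carries the
card's benchmark (F) = FermiSeaBenchmark
(is m₂ bounded for the modulus of the 3-D free-fermion ground state?) and its robust form
FermiSeaCondensate (does |Ψ_F| condense in d = 3?).
Lean: `ChiSquareTolerance ∧ DeletionReachesGroundState`

## Assembly
Pure logic over two items plus the proved zero-mode criterion (glue.lean, sorry-free, axioms
propext/Classical.choice/Quot.sound, checked in
Sketch.lean): given v admissible take ρ₁, C from ChiSquareTolerance and ρ₂ from
DeletionReachesGroundState; for ρ < min ρ₁ ρ₂ intersect the two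
eventualities in n, feed the tolerance witnesses (one per δ) into DeletionReachesGroundState at the
same C to get δ > 0 with ⟨φ₀, γ_Ψ φ₀⟩ ≥
(n+1)/(2C) for every δ-near-minimiser; shift the filter to N = n+1 (Filter.eventually_atTop, N−1+1 =
N) and rewrite 1/(2C)·N = (n+1)/(2C); this is
the hypothesis of `AtomisticToContinuum.BECInfraredBound.bec_of_zeroMode` with c = 1/(2C), whose
conclusion is the sub-problem Statement
(`_root_.BoseEinsteinCondensation`, the abbrev of the Literature conjecture). `theorem closes (hT :
ChiSquareTolerance) (hG :
DeletionReachesGroundState) : _root_.BoseEinsteinCondensation`. FermiSeaBenchmark,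
FermiSeaCondensate, DeletionBound, SpikeObstruction are not
hypotheses of `closes` (benchmark / lemma / negative side).

Rationale: WHY THIS LINE. Mechanism (two lines, verified by hand and by a refuter on the retired route): for Ψ
≥ 0 put b(Y) = ∫_xΨ², S(Y) = ∫_xΨ, A(Y) = ∫_xΨ⁴; Hölder gives
b³ ≤ S²A, Cauchy–Schwarz in Y gives 1 = (∫_Y b)² ≤ (∫_Y S²)(∫_Y A/b) = (n₀L³/N)(m₂/L³), i.e. n₀ ≥
N/m₂ — no translation invariance, no spectral
gap, no energy asymptotics, blind to the walls (free Dirichlet gas: m₂ = 27/8, torus: m₂ = 1 with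
equality), and on the Jastrow/LHY picture of the
dilute ground state (ReattoChester1967, Reatto1969, LiebSeiringerSolovejYngvason2005 Ch. 2–3) m₂ =
⟨e^(−2W)⟩/⟨e^(−W)⟩² = 1 + O(Var W) = 1 + O(√(ρa³))
because the insertion landscape W(x) = Σ_j u(x−y_j), u ≈ a/r screened at the healing length ξ, has
variance ≈ 4πρa²ξ — the Bogoliubov depletion
ORDER drops out of one inequality. Imported: point-process theory — insertion/deletion tolerance
(HolroydSoo2013 Thm 1.1–1.2), Palm measures of
determinantal processes (ShiraiTakahashi2003), rigidity versus Palm equivalence (GhoshPeres2017,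
Bufetov2018, Lyons2003), hyperuniformity
(GhoshLebowitz2017, TorquatoScardicchioZachary2008 §4.1) — as the language in which "a Bose gas
condenses when deleting one boson does not tell
you, in mean square, where it was" is a theorem schema, and DPP/random-matrix calculus
(HughesKeatingOconnell2001, BardenetHardy2020) for the
benchmark, where everything is explicit: m₂ = E_Z[1/(K_Z⁻¹)₁₁] = E_Y‖G_Y‖₄⁴ for the L²-normalised
hole function G_Y, with the exact identities
E[(K_Z⁻¹)ᵢᵢ] = 1 and E_Palm‖h‖² = N−1 (this session) available to a prover; d = 1 is Tonks–Girardeau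
(Girardeau1960, Lenard1964,
ForresterEtAl2003: n₀ ≈ 1.54√N, so m₂ ≥ 0.65√N — the bound degenerates exactly where BEC fails).
Versus the open positivity routes
(BECRieszShadow, BECLiebAntibunching, BECMeanFieldControl: torus, Palm AFFINITY γ(x,y) ≥ e^(−C)ρ
pointwise, PeriodicRigidity +
BoundaryTransferWeak frame): here ONE scalar second moment, stated directly in the Dirichlet box, no
boundary transfer, and a computable
benchmark; negatives index: only BECSwapAffinity.SwapJensen (a Jensen bound quantified over negative
constants) — every constant here is
quantified with its sign (0 < C, 0 < c, 0 < δ) and N = n+1 ≥ 1 is explicit.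

RANKED CRUXES. #2 ChiSquareTolerance (crux) — card item C1, liminf form, Dirichlet box: for every
repulsive finite-range v there is ρ₀ > 0 such that for 0 < ρ < ρ₀ there is C > 0 with: for all large
N = n+1 and every δ > 0 SOME δ-near-minimiser Ψ of the Dirichlet energy in the box of side
(N/ρ)^(1/3) has m₂(Ψ) = L³ ∫_Y ∫_x |Ψ(x::Y)|⁴ / ∫_x' |Ψ(x'::Y)|² ≤ C (equivalently, given
DeletionReachesGroundState's compactness, m₂(Ψ₀) ≤ C for the ground state; the
sup-over-near-minimisers form is false, SpikeObstruction). [difficulty: open-problem] (why it might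
fail: m₂ ≤ C forces n₀ ≥ N/C, so it is at least as strong as BEC; it breaks if the insertion
landscape −2·log Ψ₀(·,Y) has variance growing with N (the phonon tail u ∼ 1/r² is only just
square-summable in d = 3; three-body and backflow terms are uncontrolled non-perturbatively).)
[Reatto1969, ReattoChester1967, LiebSeiringerSolovejYngvason2005, HolroydSoo2013,
PenroseOnsager1956, GhoshLebowitz2017]
#3 FermiSeaBenchmark (crux) — the card's benchmark (F) in d = 3, off the deciding path: for the
bosonized Fermi sea Ψ_R = det[e^(2πi k_a·x_b)]/√N! on the unit torus, modes k ∈ ℤ³ with |k|² ≤ R²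
(closed shells, N = N(R) = 1, 7, 33, 123, 257, 515, 925, …), the mean self-conditional density is
bounded uniformly in R: (1/N!) ∫_{cell^N} |det X|⁴ / ∫_cell |det(X with x_i replaced)|² ≤ C for
every particle index i; equivalently sup_N E_{Z∼DPP(Fermi ball)}[1/(K_Z⁻¹)₁₁] < ∞, equivalently the
L²-normalised hole functions G_Y (band-limited to the Fermi ball, vanishing on the other N−1 points)
have E‖G_Y‖₄⁴ = O(1); with DeletionBound it gives n₀(|Ψ_F|) ≥ N/C. [difficulty: L] (why it might
fail: refuter preview (stmt-4368): m₂ = 2.51, 4.21, 5.84±1.68 at N = 7, 33, 123 while n₀/N = .67,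
.55, .51; if the hole function keeps an extreme-value share of its weight on the sparsest voids,
E‖G_Y‖₄⁴ ∼ log N and (F) is false although |Ψ_F| condenses (FermiSeaCondensate then records that).)
[TorquatoScardicchioZachary2008, HughesKeatingOconnell2001, ShiraiTakahashi2003, GhoshPeres2017,
Bufetov2018, Lyons2003, GroverFisher2015, BardenetHardy2020, Lenard1964, ForresterEtAl2003]
#4 DeletionReachesGroundState (crux) — card item C3, transfer to near-minimisers: for every
repulsive finite-range v there is ρ₀ > 0 such that for 0 < ρ < ρ₀, all large N = n+1 and every C >
0: IF for every δ > 0 some δ-near-minimiser has m₂ ≤ C, THEN there is δ > 0 such that EVERY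
δ-near-minimiser Ψ has constant-mode occupation ⟨φ₀, γ_Ψ φ₀⟩ ≥ N/(2C), φ₀ = L^(-3/2)·1_box. Content:
E₀ < ⊤ at low density; uniqueness and positivity of the Dirichlet ground state Ψ₀ (Perron–Frobenius
for the Friedrichs realisation, incl. hard cores); L²-convergence of near-minimisers to Ψ₀ modulo
phase (compact resolvent); lower semicontinuity of m₂ (perspective convexity + Fatou; m₂ depends on
|Ψ| only) giving m₂(Ψ₀) ≤ C; DeletionBound for Ψ₀; √n₀ is √N-Lipschitz in L². [deps: DeletionBound]
[difficulty: L] (why it might fail: needs E₀ < ⊤ and a UNIQUE positive Dirichlet ground state with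
L²-convergence of near-minimisers for every admissible v: v = ⊤ on a shell [a,b], a > 0, splits
configuration space into chambers (degenerate ground space); hard cores need connectivity of the
hard-sphere configuration space.) [ReedSimonIV1978, LiebSeiringerSolovejYngvason2005,
PenroseOnsager1956]
#9 DeletionBound (support) — the exact one-line theorem (sharpened card mechanism): for every n, L >
0 and every measurable Ψ : Config(n+1) → ℂ that is pointwise real and ≥ 0, vanishes off the box
Λ_L^(n+1) and has ∫|Ψ|² = 1: (n+1) ≤ n₀(Ψ)·m₂(Ψ), where n₀ = occupation of φ₀ = L^(-3/2)·1_box and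
m₂ = L³ ∫_Y ∫_x |Ψ(x::Y)|⁴ / ∫_x' |Ψ(x'::Y)|² (ENNReal, division-safe: 0/0 = 0 on null slices).
Proof: Hölder b³ ≤ S²A in x, then Cauchy–Schwarz in Y. No symmetry or translation invariance needed.
[difficulty: provable-now] [PenroseOnsager1956, LiebSeiringerSolovejYngvason2005]
#9 SpikeObstruction (support) — negative side, certifies the liminf form of ChiSquareTolerance: the
SUP form ("there is δ > 0 such that EVERY δ-near-minimiser has m₂ ≤ C") is FALSE already for v = 0:
adding to a smooth near-minimiser a symmetrised C¹ spike of L²-mass m ≤ δw² and width w raises m₂ by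
≳ L³δ/w at kinetic cost ≤ δ, so near-minimisers of arbitrarily small slack have unbounded m₂.
[difficulty: M] [LiebSeiringerSolovejYngvason2005]
#9 FermiSeaCondensate (support) — the robust form of the card's title question ("does |Ψ_F| condense
in d ≥ 2?") in d = 3, implied by FermiSeaBenchmark via DeletionBound and kept as the benchmark's
record if (F) dies of heavy tails: the zero-mode occupation fraction of the bosonized Fermi sea is
bounded below uniformly in the shell radius, n₀(|Ψ_R|)/N = (1/N!) ∫_{cell^N} (∫_cell |det(X with x_i
replaced by x)| dx)² dX ≥ c > 0 for every particle index i (the squared L¹-mass of the L²-normalised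
hole function, E[(∫|G_Y|)²] ≥ c). [difficulty: L] [Lenard1964, ForresterEtAl2003,
TorquatoScardicchioZachary2008, GroverFisher2015]

TWO-LAYER PLAN. Foreseen glued splits (filed only when a crux closes or stalls): ChiSquareTolerance
⇐ TorusTolerance (the same bound m₂ ≤ 1 + C√(ρa³) for the
periodic ground state, where m₂ = 1 + χ²(Palm ‖ marginal) literally) → WallLayerTransfer (Dirichlet
conditional density ≤ C/L³ off a healing-length
boundary layer) → ChiSquareTolerance; alternatively ChiSquareTolerance ⇐ PapangelouSecondMoment
(second moment of the GNZ conditional intensity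
λ*(x|Y)/ρ of |Ψ₀|² via local energy / Feynman–Kac ratio bounds) → ChiSquareTolerance.
DeletionReachesGroundState ⇐ GroundStateConvergence (E₀ < ⊤,
unique positive Ψ₀, near-minimisers → Ψ₀ in L² mod phase; candidate to share with the Dirichlet
rigidity items of other positivity routes) →
SemicontinuityTransfer (lsc of m₂, continuity of n₀, DeletionBound) → DeletionReachesGroundState.
FermiSeaCondensate ⇐ FermiSeaBenchmark →
DeletionBound (torus cell = box up to a null set, particle i ↔ particle 0 by symmetry) →
FermiSeaCondensate. If ChiSquareTolerance dies of heavy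
tails while BEC holds, the pivot (not filed now) is HarmonicTolerance: T(Ψ₀) := ∫_Y b³/(L³A) ≥ c,
the harmonic-mean form with
n₀/N ≥ T ≥ 1/m₂ by the same Hölder line, robust to rare bath configurations.

KILL CRITERIA. A proof that m₂(Ψ₀) → ∞ along N for the Dirichlet (or periodic) ground state of some
admissible v at arbitrarily small ρ refutes ChiSquareTolerance:
pivot once to HarmonicTolerance (above) by `workitem add` + new glue; if that is refuted too, close
`refuted:ChiSquareTolerance` — neither refutes the
conjunct (the positivity programme falls back to the KL / Rényi-½ criteria of cards
renyi-entropic-delocalisation, swap-affinity-insertion-variance).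
¬DeletionReachesGroundState exhibited through a degenerate Dirichlet ground space for an exotic v
(chambers of v = ⊤ on a shell) forces a restatement
of rank 4 for v finite a.e. plus genuine hard cores (repair, not close). ¬FermiSeaBenchmark (m₂ ∼
log N or N^γ for the 3-D Fermi ball) does not touch
the deciding theorem: it is recorded as the negative benchmark and FermiSeaCondensate becomes the
live benchmark question; ¬FermiSeaCondensate ("the
bosonized 3-D Fermi sea does not condense") would be a striking negative fact worth a Literature
barrier entry. X_B1 (stmt-AtomisticToContinuum-0686),
PeriodicBEC + BoundaryTransferWeak, or any other route's target proved elsewhere moots the route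
(conjunct closed).

NOT DECOMPOSED YET. How to bound m₂ for the true ground state (GNZ/Campbell identity E[Σ_i h(x_i,
X∖x_i)] = ∫ E_{P_x}[h] ρ dx, the Papangelou intensity, Feynman–Kac
ratio bounds for Ψ₀(x,Y)/Ψ₀(x',Y), screening of the a/r tail at ξ) — layer-2 children of rank 2; the
periodic twin and its link to PeriodicBEC
(stmt-AtomisticToContinuum-0826); the λ_max version tr ρ₁² ≥ m₂^(−2) of the inequality (no
positivity of the mode needed); the d = 2 benchmark and the
d = 1 negative calibration (lives in
Literature.Barriers.AtomisticToContinuum.OneDimensionalHardCore); the spectral/compactness package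
behind
rank 4 (shared need of every positivity route); positive temperature; constants.

CHEAPEST FALSIFIER. Exact HKPV sampling of the Fermi-ball projection DPP on the unit torus at the
closed shells N = 7…925 (d = 3), with d = 2 (N = 13…441) and d = 1
(N = 7…515, must show Lenard/HKO growth) as controls: per sample Z invert Φ = [e^(2πi k·z_j)], D_i =
1/‖Φ⁻¹e_i‖², m₂(N) = E[(1/N)Σ_i D_i] (and its
exact IPR form E‖G_Y‖₄⁴ by FFT), T = E[1/‖G_Y‖₄⁴], n₀/N = E[(∫|l_i|)²/‖l_i‖²], plus tail quantiles
of D_i. Saturation of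
m₂ in d = 3 supports (F); growth ∼ log N kills (F) but not the route; n₀/N → 0 would kill
FermiSeaCondensate. Refuter preview on stmt-4368 (N ≤ 123):
d = 3 m₂ = 2.51, 4.21, 5.84±1.68, n₀/N = 0.673, 0.545, 0.514; d = 1 m₂ = 3.69, 12.9, 38.8, n₀/N =
0.506, 0.249, 0.148. This session: fermi_benchmark/main.py
submitted as kit jobs (j003609 smoke + full run, ids in NOTES.md); results go to the rank-3 item as
evidence. For rank 2 directly: classical Monte Carlo
of the scattering-solution Jastrow fluid (ρa³ = 1e-3…1e-1, N = 100…1000), m₂ = ⟨e^(−2ΔW)⟩/⟨e^(−ΔW)⟩²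
by Widom insertion — growth with N kills the line at
trial-state level. Known-theorem check: v = 0 passes all items (Dirichlet m₂ = 27/8, n₀/N = 0.533 ≥
8/27; torus m₂ = 1, n₀ = N, equality).

NUMBERS. Free gas, Dirichlet box: m₂ = (3/2)³ = 3.375, n₀/N = (8/π²)³ = 0.5331, bound 1/m₂ = 0.2963.
Free gas, torus: m₂ = 1, n₀ = N (DeletionBound is an
equality). Tonks–Girardeau (d = 1, = |Fermi sea|): n₀ ≈ 1.54√N (Lenard1964, ForresterEtAl2003) so m₂
≥ 0.65√N. Jastrow heuristic for the dilute 3-D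
gas: Var_x W ≈ 16πρa²ξ = 16π(8π)^(−1/2)√(ρa³) ≈ 10√(ρa³), so m₂ − 1 = O(√(ρa³)) against the
Bogoliubov depletion (8/(3√π))√(ρa³) ≈ 1.50√(ρa³): right
order, constant not sharp. Exact DPP identities (unit torus, any d): E[(K_Z⁻¹)ᵢᵢ] = E‖l_i‖₂² = 1,
E_Palm‖h‖² = N − 1 with D = N/(1+‖h‖²), hence
m₂ ≥ 1 by Jensen with equality iff ‖h‖² is deterministic. Closed-shell N for |k|² ≤ R² in d = 3: 1,
7, 33, 123, 257, 515, 925; d = 2: 1, 5, 13, 29,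
49, 81, 113, 149, 197, 253, 317, 377, 441. Items at open: 7 (3 cruxes, 3 support, 1 assembly).

DEFINITION REQUESTS. None blocking. One convenience definition may be filed later (--for the rank-2
item): `meanSelfDensity (n : ℕ) (L : ℝ) (Ψ : Config (n+1) → ℂ) :
ENNReal := ENNReal.ofReal (L^3) * ∫⁻ Y, ∫⁻ x, ‖Ψ (x::Y)‖₊^4 / ∫⁻ x', ‖Ψ (x'::Y)‖₊^2` under
Summits/AtomisticToContinuum/BoseEinsteinCondensation/Theorems,
so that layer-2 children and the periodic twin are short; the items filed now inline it
(definitional unfolding).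

Novelty: Searches (2026-08-15, this session; the card carries five refuter novelty audits, AUDIT-35
confirming new-combination): `lit search "absolute value
Slater determinant boson wave function Bose-Einstein condensation off-diagonal long-range order
three dimensions"` and `lit search --hybrid
"conditional density lower bound condensate fraction positive ground state Hölder"` (literature
service intermittently unavailable on this hub,
rc 75; re-run results logged in NOTES.md when the daemon answers); ledger: `ledger negatives
--problem AtomisticToContinuum` (6, one BEC: SwapJensen),
Theses/*.lean status census (23 open BEC routes, none with the m₂ functional), items
stmt-AtomisticToContinuum-4367/4368 with refuter evidence
(route review 13:52Z: DeletionBound verified by hand, SpikeObstruction true, Fermi preview). Prior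
searches inherited from the retired route and the
card audits: crossref "lower bound condensate fraction Jastrow wave function Jensen inequality Bose"
(12: doi:10.1103/physreva.18.296,
doi:10.1103/physrevb.22.1237, Leggett NJP 2001 upper bound doi:10.1088/1367-2630/3/1/323 — no
Hölder/conditional-density lower bound); crossref
"Bufetov quasi-symmetries determinantal" (doi:10.1214/17-aop1198, doi:10.1134/s0016266320010025);
zbMATH "determinantal point process deletion
tolerance Palm measure absolutely continuous higher dimensions" (0); READ HolroydSoo2013 pp 2–3,
TorquatoScardicchioZachary2008 §4.1, GroverFisher2015
(arXiv:1412.3534: Rényi-2 of |random Slater| numeric  [refs: 10.1103/physreva.18.296, 10.1103/physrevb.22.1237, 10.1088/1367-2630/3/1/323, 10.1214/17-aop1198, 10.1134/s0016266320010025, 10.1215/00127094-2017-0002, 10.1214/ejp.v18-2621, 1412.3534, doi:10.1103/physreva.18.296, doi:10.1103/physrevb.22.1237, doi:10.1088/1367-2630/3/1/323, doi:10.1214/17-aop1198, doi:10.1134/s0016266320010025, doi:10.1215/00127094-2017-0002, doi:10.1214/ejp.v18-2621, HolroydSoo2]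

Barriers (technique_class: ground-state-positivity point-process palm-chi-square): - technique_class: ground-state-positivity point-process palm-chi-square
- Literature.Barriers.AtomisticToContinuum.KineticGapLengthScales: evaded — no spectral gap at scale
L, no Poincaré inequality, no localisation to sub-boxes; m₂ is bounded directly as a property of the
conditional law of one particle, never through (box side)² × (excess energy); the fixed-N gap enters
only rank 4 (N fixed, δ → 0).
- Literature.Barriers.AtomisticToContinuum.EnergyAsymptoticsWithoutCondensation: evaded — no energy
asymptotics are used; the 1-D Lieb–Liniger/Tonks witness is exactly where m₂ diverges (m₂ ≥ 0.65√N),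
consistent.
- Literature.Barriers.AtomisticToContinuum.BogoliubovPerturbationInfrared: not met by the inequality
or the benchmark; it would bite a PERTURBATIVE evaluation of E_μ[L³p] for |Ψ₀|² (the shot-noise
second moment of the insertion landscape must be controlled non-perturbatively at the healing scale)
— conceded in rank 2's why-might-fail; the bet is that a second moment of e^(−W) needs screening of
the a/r tail at ξ (a positivity/Feynman–Kac statement), not the Beliaev propagator.
- Literature.Barriers.AtomisticToContinuum.OneDimensionalHardCore: respected and used as calibration
(d = 1: |Fermi sea| = Girardeau's state, zero-momentum occupation ∼ √N, so the bound degenerates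
exactly as it must).
- Literature.Barriers.AtomisticToContinuum.HohenbergLowDimension: respected — T = 0 only; dimension
enters through the infrared square-summability of the landscape tail (α = 1 < d)

History (route lifecycle, newest last):
- 2026-08-15T19:10:20Z · rev 1: restated FermiSeaBenchmark (stmt-AtomisticToContinuum-11944), FermiSeaCondensate (stmt-AtomisticToContinuum-11948) — cone repair (route-repair unit rrepair-AtomisticToContinuum-BECDeleti-ed1f2072): drop `import Literature.MathematicalPhysics.QuantumManyBody.PeriodicBoseGas` — (planner-rrepair-AtomisticToContinuum-BECDeleti-ed1f2072-0)
- 2026-08-23T03:24:44Z · DORMANT — reconciler: no traction for 5.9 d (last activity item-evidence-added at 2026-08-17T06:02:59Z); parked, not closed — `ledger route dormant route-AtomisticToConti (operator:999:2411111)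

sub-problem: BoseEinsteinCondensation · status: dormant · opened planner-plancard-AtomisticToContinuum-BoseEin-95b2a624-g2-0 2026-08-15T18:46:26Z · rev 2 · ledger route-AtomisticToContinuum-BECDeletionChiSquare
GENERATED by the gate from the ledger (D-0016/17). Provers cite these decls: `theorem foo : Summit.AtomisticToContinuum.BoseEinsteinCondensation.Theses.BECDeletionChiSquare.<Decl> := …` in Summits/AtomisticToContinuum/BoseEinsteinCondensation/Theorems/<Name>.lean.
-/

namespace Summit.AtomisticToContinuum.BoseEinsteinCondensation.Theses.BECDeletionChiSquare

open scoped BigOperators Topology Manifold Classical MeasureTheory ProbabilityTheory Matrix InnerProductSpace ComplexConjugate ContinuousMap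
open Filter Set Function TopologicalSpace MeasureTheory

attribute [summit_statement] _root_.BoseEinsteinCondensation

/-- item stmt-AtomisticToContinuum-11937 · crux · rank 2 · open · by planner
why it might fail: Implies BEC outright (m2 <= C gives n0 >= N/C): needs non-perturbative near-uniformity in x of p(x|Y) ~ Psi0(x,Y)^2 for the TRUE ground state; beyond the Jastrow/LHY picture nothing controls E_Y||p(.|Y)||^2 (three-body terms, 1/r^2 phonon tail, Bogoliubov IR barrier); d=1: m2 >= 0.65 sqrt N.
sources: LiebSeiringerSolovejYngvason2005, Reatto1969, ReattoChester1967, HolroydSoo2013, PenroseOnsager1956, GhoshLebowitz2017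
[crux] card item C1, liminf form, Dirichlet box: for every repulsive finite-range v there is ρ₀ > 0
such that for 0 < ρ < ρ₀ there is C > 0 with: for all large N = n+1 and every δ > 0 SOME
δ-near-minimiser Ψ of the Dirichlet energy in the box of side (N/ρ)^(1/3) has m₂(Ψ) = L³ ∫_Y ∫_x
|Ψ(x::Y)|⁴ / ∫_x' |Ψ(x'::Y)|² ≤ C (equivalently, given DeletionReachesGroundState's compactness,
m₂(Ψ₀) ≤ C for the ground state; the sup-over-near-minimisers form is false, SpikeObstruction).
[difficulty: open-problem] -/
@[route_item "route-AtomisticToContinuum-BECDeletionChiSquare", crux]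
def ChiSquareTolerance : Prop :=
  ∀ v : ℝ → ENNReal, Literature.MathematicalPhysics.QuantumManyBody.BoseGas.IsRepulsiveFiniteRange v → ∃ ρ₀ : ℝ, 0 < ρ₀ ∧ ∀ ρ : ℝ, 0 < ρ → ρ < ρ₀ → ∃ C : ℝ, 0 < C ∧ ∀ᶠ n : ℕ in Filter.atTop, ∀ δ : ENNReal, 0 < δ → ∃ Ψ : Literature.MathematicalPhysics.QuantumManyBody.BoseGas.TrialState (n + 1) (Literature.MathematicalPhysics.QuantumManyBody.BoseGas.sideLength ρ (n + 1)), Literature.MathematicalPhysics.QuantumManyBody.BoseGas.energy v Ψ ≤ Literature.MathematicalPhysics.QuantumManyBody.BoseGas.groundStateEnergy v (n + 1) (Literature.MathematicalPhysics.QuantumManyBody.BoseGas.sideLength ρ (n + 1)) + δ ∧ ENNReal.ofReal (Literature.MathematicalPhysics.QuantumManyBody.BoseGas.sideLength ρ (n + 1) ^ 3) * (∫⁻ Y : Literature.MathematicalPhysics.QuantumManyBody.BoseGas.Config n, ∫⁻ x : Literature.MathematicalPhysics.QuantumManyBody.BoseGas.Space, (‖Ψ.ψ (Matrix.vecCons x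 Y)‖₊ : ENNReal) ^ 4 / (∫⁻ x' : Literature.MathematicalPhysics.QuantumManyBody.BoseGas.Space, (‖Ψ.ψ (Matrix.vecCons x' Y)‖₊ : ENNReal) ^ 2)) ≤ ENNReal.ofReal C

-- earlier FermiSeaBenchmark (stmt-AtomisticToContinuum-11944, replaced 2026-08-15T19:10:20Z -> stmt-AtomisticToContinuum-14628): retired by None — ∃ C : ℝ, ∀ R : ℕ, let S : Finset (Fin 3 → ℤ) := (Fintype.piFinset fun _ : Fin 3 => Finset.Icc (-(R : ℤ)) R).filter (fun k => ∑ j, k j ^ 2 ≤ (R : ℤ) ^ 2); ∀ i : Fin S.card, ((Nat.factorial S.card : ENNReal))⁻¹ * (∫⁻ X in Literature.MathematicalPhysics.Quan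
/-- item stmt-AtomisticToContinuum-14628 · crux · rank 3 · open · by planner
why it might fail: Refuter preview (stmt-..-4368): m2 = 2.51, 4.21, 5.84+-1.68 at N = 7, 33, 123 - no saturation, fits ~1.25 log N; bounded chi^2 (E||G_Y||_4^4 = O(1)) is strictly stronger than deletion tolerance / Palm absolute continuity, itself unproved for the d=3 Fermi-ball DPP (d=1 is rigid: m2 >~ sqrt N).
sources: HolroydSoo2013, GhoshPeres2017, GhoshLebowitz2017, Lyons2003, Bufetov2018, ShiraiTakahashi2003
[crux] the card's benchmark (F) in d = 3, off the deciding path: for the bosonized Fermi sea Ψ_R =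
det[e^(2πi k_a·x_b)]/√N! on the unit torus, modes k ∈ ℤ³ with |k|² ≤ R² (closed shells, N = N(R) =
1, 7, 33, 123, 257, 515, 925, …), the mean self-conditional density is bounded uniformly in R:
(1/N!) ∫_{cell^N} |det X|⁴ / ∫_cell |det(X with x_i replaced)|² ≤ C for every particle index i;
equivalently sup_N E_{Z∼DPP(Fermi ball)}[1/(K_Z⁻¹)₁₁] < ∞, equivalently the L²-normalised hole
functions G_Y (band-limited to the Fermi ball, vanishing on the other N−1 points) have E‖G_Y‖₄⁴ =
O(1); with DeletionBound it gives n₀(|Ψ_F|) ≥ N/C. (unit cell [0,1)³ = BoseGas.cell 1 / cellN N 1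
written inline as {y | ∀ j, y j ∈ Ico 0 1} / {Z | ∀ b j, Z b j ∈ Ico 0 1}; cone repair 2026-08-15:
definitionally the rev-0 statement (Iff.rfl), PeriodicBoseGas import dropped) [deps: DeletionBound]
[difficulty: L] -/
@[route_item "route-AtomisticToContinuum-BECDeletionChiSquare"]
def FermiSeaBenchmark : Prop :=
  ∃ C : ℝ, ∀ R : ℕ, let S : Finset (Fin 3 → ℤ) := (Fintype.piFinset fun _ : Fin 3 => Finset.Icc (-(R : ℤ)) R).filter (fun k => ∑ j, k j ^ 2 ≤ (R : ℤ) ^ 2); ∀ i : Fin S.card, ((Nat.factorial S.card : ENNReal))⁻¹ * (∫⁻ X in {Z : Literature.MathematicalPhysics.QuantumManyBody.BoseGas.Config S.card | ∀ b j, Z b j ∈ Set.Ico (0 : ℝ) 1}, (‖(Matrix.of fun a b : Fin S.card => Complex.exp (2 * Real.pi * Complex.I * ∑ j : Fin 3, (((S.equivFin.symm a : Fin 3 → ℤ) j : ℝ) : ℂ) * ((X b j : ℝ) : ℂ))).det‖₊ : ENNReal) ^ 4 / (∫⁻ x in {y : Literature.MathematicalPhysics.QuantumManyBody.BoseGas.Space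 | ∀ j, y j ∈ Set.Ico (0 : ℝ) 1}, (‖(Matrix.of fun a b : Fin S.card => Complex.exp (2 * Real.pi * Complex.I * ∑ j : Fin 3, (((S.equivFin.symm a : Fin 3 → ℤ) j : ℝ) : ℂ) * ((Function.update X i x b j : ℝ) : ℂ))).det‖₊ : ENNReal) ^ 2)) ≤ ENNReal.ofReal C

/-- item stmt-AtomisticToContinuum-11945 · crux · rank 4 · open · by planner
why it might fail: v may be TOP on any measurable subset of [0,R0] (hard cores/shells), so the finite-energy region can disconnect (hard spheres in a box: connectivity for all large N unproved), the ground space may degenerate and the all-delta-some-Psi => some-delta-all-Psi step fail; routine for v < TOP a.e.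
sources: ReedSimonIV1978, BaryshnikovBubenikKahle2013, Kahle2012, DiaconisLebeauMichel2010, LiebSeiringerSolovejYngvason2005
[crux] card item C3, transfer to near-minimisers: for every repulsive finite-range v there is ρ₀ > 0
such that for 0 < ρ < ρ₀, all large N = n+1 and every C > 0: IF for every δ > 0 some
δ-near-minimiser has m₂ ≤ C, THEN there is δ > 0 such that EVERY δ-near-minimiser Ψ has
constant-mode occupation ⟨φ₀, γ_Ψ φ₀⟩ ≥ N/(2C), φ₀ = L^(-3/2)·1_box. Content: E₀ < ⊤ at low density;
uniqueness and positivity of the Dirichlet ground state Ψ₀ (Perron–Frobenius for the Friedrichs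
realisation, incl. hard cores); L²-convergence of near-minimisers to Ψ₀ modulo phase (compact
resolvent); lower semicontinuity of m₂ (perspective convexity + Fatou; m₂ depends on |Ψ| only)
giving m₂(Ψ₀) ≤ C; DeletionBound for Ψ₀; √n₀ is √N-Lipschitz in L². [deps: DeletionBound]
[difficulty: L] -/
@[route_item "route-AtomisticToContinuum-BECDeletionChiSquare", crux]
def DeletionReachesGroundState : Prop :=
  ∀ v : ℝ → ENNReal, Literature.MathematicalPhysics.QuantumManyBody.BoseGas.IsRepulsiveFiniteRange v → ∃ ρ₀ : ℝ, 0 < ρ₀ ∧ ∀ ρ : ℝ, 0 < ρ → ρ < ρ₀ → ∀ᶠ n : ℕ in Filter.atTop, ∀ C : ℝ, 0 < C → (∀ δ : ENNReal, 0 < δ → ∃ Ψ : Literature.MathematicalPhysics.QuantumManyBody.BoseGas.TrialState (n + 1) (Literature.MathematicalPhysics.QuantumManyBody.BoseGas.sideLength ρ (n + 1)), Literature.MathematicalPhysics.QuantumManyBody.BoseGas.energy v Ψ ≤ Literature.MathematicalPhysics.QuantumManyBody.BoseGas.groundStateEnergy v (n + 1) (Literature.MathematicalPhysics.QuantumManyBody.BoseGas.sideLength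 ρ (n + 1)) + δ ∧ ENNReal.ofReal (Literature.MathematicalPhysics.QuantumManyBody.BoseGas.sideLength ρ (n + 1) ^ 3) * (∫⁻ Y : Literature.MathematicalPhysics.QuantumManyBody.BoseGas.Config n, ∫⁻ x : Literature.MathematicalPhysics.QuantumManyBody.BoseGas.Space, (‖Ψ.ψ (Matrix.vecCons x Y)‖₊ : ENNReal) ^ 4 / (∫⁻ x' : Literature.MathematicalPhysics.QuantumManyBody.BoseGas.Space, (‖Ψ.ψ (Matrix.vecCons x' Y)‖₊ : ENNReal) ^ 2)) ≤ ENNReal.ofReal C) → ∃ δ : ENNReal, 0 < δ ∧ ∀ Ψ : Literature.MathematicalPhysics.QuantumManyBody.BoseGas.TrialState (n + 1) (Literature.MathematicalPhysics.QuantumManyBody.BoseGas.sideLength ρ (n + 1)), Literature.MathematicalPhysics.QuantumManyBody.BoseGas.energy v Ψ ≤ Literature.MathematicalPhysics.QuantumManyBody.BoseGas.groundStateEnergy v (n + 1) (Literature.MathematicalPhysics.QuantumManyBody.BoseGas.sideLength ρ (n + 1)) + δ → ENNReal.ofReal ((n + 1) / (2 * C)) ≤ Literature.MathematicalPhysics.QuantumManyBody.BoseGas.occupation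 (n + 1) ((Literature.MathematicalPhysics.QuantumManyBody.BoseGas.box (Literature.MathematicalPhysics.QuantumManyBody.BoseGas.sideLength ρ (n + 1))).indicator fun _ => ((Real.sqrt (Literature.MathematicalPhysics.QuantumManyBody.BoseGas.sideLength ρ (n + 1) ^ 3))⁻¹ : ℂ)) Ψ.ψ

/-- item stmt-AtomisticToContinuum-11946 · support · rank 9 · open · by planner
sources: PenroseOnsager1956, LiebSeiringerSolovejYngvason2005
[support] the exact one-line theorem (sharpened card mechanism): for every n, L > 0 and every
measurable Ψ : Config(n+1) → ℂ that is pointwise real and ≥ 0, vanishes off the box Λ_L^(n+1) and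
has ∫|Ψ|² = 1: (n+1) ≤ n₀(Ψ)·m₂(Ψ), where n₀ = occupation of φ₀ = L^(-3/2)·1_box and m₂ = L³ ∫_Y ∫_x
|Ψ(x::Y)|⁴ / ∫_x' |Ψ(x'::Y)|² (ENNReal, division-safe: 0/0 = 0 on null slices). Proof: Hölder b³ ≤
S²A in x, then Cauchy–Schwarz in Y. No symmetry or translation invariance needed. [difficulty:
provable-now] -/
@[route_item "route-AtomisticToContinuum-BECDeletionChiSquare"]
def DeletionBound : Prop :=
  ∀ (n : ℕ) (L : ℝ), 0 < L → ∀ Ψ : Literature.MathematicalPhysics.QuantumManyBody.BoseGas.Config (n + 1) → ℂ, Measurable Ψ → (∀ X, X ∉ Literature.MathematicalPhysics.QuantumManyBody.BoseGas.boxN (n + 1) L → Ψ X = 0) → (∀ X, (Ψ X).im = 0 ∧ 0 ≤ (Ψ X).re) → ∫⁻ X, (‖Ψ X‖₊ : ENNReal) ^ 2 = 1 → ((n + 1 : ℕ) : ENNReal) ≤ Literature.MathematicalPhysics.QuantumManyBody.BoseGas.occupation (n + 1) ((Literature.MathematicalPhysics.QuantumManyBody.BoseGas.box L).indicator fun _ =>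 ((Real.sqrt (L ^ 3))⁻¹ : ℂ)) Ψ * (ENNReal.ofReal (L ^ 3) * (∫⁻ Y : Literature.MathematicalPhysics.QuantumManyBody.BoseGas.Config n, ∫⁻ x : Literature.MathematicalPhysics.QuantumManyBody.BoseGas.Space, (‖Ψ (Matrix.vecCons x Y)‖₊ : ENNReal) ^ 4 / (∫⁻ x' : Literature.MathematicalPhysics.QuantumManyBody.BoseGas.Space, (‖Ψ (Matrix.vecCons x' Y)‖₊ : ENNReal) ^ 2)))

/-- item stmt-AtomisticToContinuum-11947 · support · rank 9 · open · by planner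
sources: LiebSeiringerSolovejYngvason2005
[support] negative side, certifies the liminf form of ChiSquareTolerance: the SUP form ("there is δ
> 0 such that EVERY δ-near-minimiser has m₂ ≤ C") is FALSE already for v = 0: adding to a smooth
near-minimiser a symmetrised C¹ spike of L²-mass m ≤ δw² and width w raises m₂ by ≳ L³δ/w at kinetic
cost ≤ δ, so near-minimisers of arbitrarily small slack have unbounded m₂. [difficulty: M] -/
@[route_item "route-AtomisticToContinuum-BECDeletionChiSquare"]
def SpikeObstruction : Prop :=
  ¬ (∀ v : ℝ → ENNReal, Literature.MathematicalPhysics.QuantumManyBody.BoseGas.IsRepulsiveFiniteRange v → ∃ ρ₀ : ℝ, 0 < ρ₀ ∧ ∀ ρ : ℝ, 0 < ρ → ρ < ρ₀ → ∃ C : ℝ, 0 < C ∧ ∀ᶠ n : ℕ in Filter.atTop, ∃ δ : ENNReal, 0 < δ ∧ ∀ Ψ : Literature.MathematicalPhysics.QuantumManyBody.BoseGas.TrialState (n + 1) (Literature.MathematicalPhysics.QuantumManyBody.BoseGas.sideLength ρ (n + 1)), Literature.MathematicalPhysics.QuantumManyBody.BoseGas.energy v Ψ ≤ Literature.MathematicalPhysics.QuantumManyBody.BoseGas.groundStateEnergy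 v (n + 1) (Literature.MathematicalPhysics.QuantumManyBody.BoseGas.sideLength ρ (n + 1)) + δ → ENNReal.ofReal (Literature.MathematicalPhysics.QuantumManyBody.BoseGas.sideLength ρ (n + 1) ^ 3) * (∫⁻ Y : Literature.MathematicalPhysics.QuantumManyBody.BoseGas.Config n, ∫⁻ x : Literature.MathematicalPhysics.QuantumManyBody.BoseGas.Space, (‖Ψ.ψ (Matrix.vecCons x Y)‖₊ : ENNReal) ^ 4 / (∫⁻ x' : Literature.MathematicalPhysics.QuantumManyBody.BoseGas.Space, (‖Ψ.ψ (Matrix.vecCons x' Y)‖₊ : ENNReal) ^ 2)) ≤ ENNReal.ofReal C)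

-- earlier FermiSeaCondensate (stmt-AtomisticToContinuum-11948, replaced 2026-08-15T19:10:20Z -> stmt-AtomisticToContinuum-14629): retired by None — ∃ c : ℝ, 0 < c ∧ ∀ R : ℕ, let S : Finset (Fin 3 → ℤ) := (Fintype.piFinset fun _ : Fin 3 => Finset.Icc (-(R : ℤ)) R).filter (fun k => ∑ j, k j ^ 2 ≤ (R : ℤ) ^ 2); ∀ i : Fin S.card, ENNReal.ofReal c ≤ ((Nat.factorial S.card : ENNReal))⁻¹ * ∫⁻ X in Literatu
/-- item stmt-AtomisticToContinuum-14629 · support · rank 9 · open · by planner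
sources: Lenard1964, ForresterEtAl2003, TorquatoScardicchioZachary2008, GroverFisher2015
[support] the robust form of the card's title question ("does |Ψ_F| condense in d ≥ 2?") in d = 3,
implied by FermiSeaBenchmark via DeletionBound and kept as the benchmark's record if (F) dies of
heavy tails: the zero-mode occupation fraction of the bosonized Fermi sea is bounded below uniformly
in the shell radius, n₀(|Ψ_R|)/N = (1/N!) ∫_{cell^N} (∫_cell |det(X with x_i replaced by x)| dx)² dX
≥ c > 0 for every particle index i (the squared L¹-mass of the L²-normalised hole function,
E[(∫|G_Y|)²] ≥ c). (unit cell [0,1)³ = BoseGas.cell 1 / cellN N 1 written inline as {y | ∀ j, y j ∈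
Ico 0 1} / {Z | ∀ b j, Z b j ∈ Ico 0 1}; cone repair 2026-08-15: definitionally the rev-0 statement
(Iff.rfl), PeriodicBoseGas import dropped) [deps: FermiSeaBenchmark, DeletionBound] [difficulty: L] -/
@[route_item "route-AtomisticToContinuum-BECDeletionChiSquare"]
def FermiSeaCondensate : Prop :=
  ∃ c : ℝ, 0 < c ∧ ∀ R : ℕ, let S : Finset (Fin 3 → ℤ) := (Fintype.piFinset fun _ : Fin 3 => Finset.Icc (-(R : ℤ)) R).filter (fun k => ∑ j, k j ^ 2 ≤ (R : ℤ) ^ 2); ∀ i : Fin S.card, ENNReal.ofReal c ≤ ((Nat.factorial S.card : ENNReal))⁻¹ * ∫⁻ X in {Z : Literature.MathematicalPhysics.QuantumManyBody.BoseGas.Config S.card | ∀ b j, Z b j ∈ Set.Ico (0 : ℝ) 1}, (∫⁻ x in {y : Literature.MathematicalPhysics.QuantumManyBody.BoseGas.Space | ∀ j, y j ∈ Set.Ico (0 : ℝ) 1}, (‖(Matrix.of fun a b : Fin S.card => Complex.exp (2 * Real.pi * Complex.I * ∑ j : Fin 3, (((S.equivFin.symm a : Fin 3 → ℤ) j : ℝ)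 : ℂ) * ((Function.update X i x b j : ℝ) : ℂ))).det‖₊ : ENNReal)) ^ 2

/-- item stmt-AtomisticToContinuum-11949 · assembly · rank 1 · open · by planner
sources: LiebSeiringerSolovejYngvason2005, PenroseOnsager1956
[assembly] ChiSquareTolerance → DeletionReachesGroundState → BoseEinsteinCondensation (the
sub-problem Statement; proof = the `closes` term, `assembly_holds` in Sketch.lean). -/
@[route_item "route-AtomisticToContinuum-BECDeletionChiSquare"]
def Assembly : Prop :=
  ChiSquareTolerance → DeletionReachesGroundState → _root_.BoseEinsteinCondensation

/-! D-0027 §2.1 — DECIDING THEOREM (planner-authored via `route open/edit --closes-file`; by planner-rrepair-AtomisticToContinuum-BECDeleti-ed1f2072-0 2026-08-15T19:10:20Z):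
its hypotheses are this route's items and its conclusion the sub-problem Statement (glue_lint), and it elaborates with this file. -/

@[closes "route-AtomisticToContinuum-BECDeletionChiSquare"] theorem closes (hT : ChiSquareTolerance) (hG : DeletionReachesGroundState) :
    _root_.BoseEinsteinCondensation := by
  refine _root_.AtomisticToContinuum.BECInfraredBound.bec_of_zeroMode fun v hv => ?_
  obtain ⟨ρ₁, hρ₁, H₁⟩ := hT v hv
  obtain ⟨ρ₂, hρ₂, H₂⟩ := hG v hv
  refine ⟨min ρ₁ ρ₂, lt_min hρ₁ hρ₂, fun ρ hρ hρlt => ?_⟩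
  obtain ⟨C, hC, hev₁⟩ := H₁ ρ hρ (lt_of_lt_of_le hρlt (min_le_left _ _))
  have hev₂ := H₂ ρ hρ (lt_of_lt_of_le hρlt (min_le_right _ _))
  refine ⟨1 / (2 * C), by positivity, ?_⟩
  have hev := hev₁.and hev₂
  rw [Filter.eventually_atTop] at hev
  obtain ⟨a, ha⟩ := hev
  rw [Filter.eventually_atTop]
  refine ⟨a + 1, fun N hN => ?_⟩
  obtain ⟨n, rfl⟩ : ∃ n, N = n + 1 := ⟨N - 1, by omega⟩
  obtain ⟨h₁, h₂⟩ := ha n (by omega)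
  obtain ⟨δ, hδ, hΨ⟩ := h₂ C hC h₁
  refine ⟨δ, hδ, fun Ψ hE => ?_⟩
  have hcast : (1 / (2 * C)) * ((n + 1 : ℕ) : ℝ) = ((n : ℝ) + 1) / (2 * C) := by
    push_cast; ring
  rw [hcast]
  exact hΨ Ψ hE

end Summit.AtomisticToContinuum.BoseEinsteinCondensation.Theses.BECDeletionChiSquare
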